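import Mathlib
import Summits.ValiantsHypothesis.ValiantsHypothesis.Theorems.DivisionGapPerCofactorDegreeReductionStubGadgetPlacement

/-!
# `DivisionGap.PerCofactorDegreeReduction` (stmt-ValiantsHypothesis-15046), line `Sketch_ideator4`:
an interleaved hole in a Hamiltonian 2-factor (stub `stub_twoFactorHole`, M)

Cells are `(row, col)`; a permutation `σ` is the perfect matching with cells `(σ i, i)`.  Let
`π₀ ⊔ ρ₀` be a Hamiltonian 2-factor (`π₀⁻¹ρ₀` an `n`-cycle) and let `col t` (`t < n`) be its orbit
enumeration (`GadgetPlacement.exists_orbit`): with the rows `r t = ρ₀ (col t) = π₀ (col (t+1))`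
the 2-factor is the `2n`-cycle `… col t — r t — col (t+1) — r (t+1) — …` (indices mod `n`).

For `K = ⌊n/3⌋` remove the columns `ec b = col (3b)` and the rows `er a = r (3a+1)` (`a, b < K`).
* The block `er × ec` carries no cell of the 2-factor: the two rows adjacent to `col (3b)` are
  `r (3b)` and `r (3b-1)` (cyclically `r (n-1)` for `b = 0`), never of an index `≡ 1 (mod 3)`
  below `3K` (for `b = 0` because `3K ≤ n`).
* What is left of the `2n`-cycle is a union of paths, each perfectly matched inside the 2-factor by
  `M₀`: `col (3s+1) ↦ r (3s)` (a `π₀`-cell), `col (3s+2) ↦ r (3s+2)` (a `ρ₀`-cell), and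
  `col t ↦ r t` on the tail arc `t ≥ 3K` (`ρ₀`-cells); the rows used avoid the removed rows and
  are pairwise distinct.
All checks are index arithmetic along the orbit.  No definitions in this file. [folklore]
-/

noncomputable section

-- `Summit.ValiantsHypothesis.ValiantsHypothesis.…` is the tree's mandated single-conjunct layout
-- (Sub = Summit), so the duplicated namespace component is intended.
set_option linter.dupNamespace false

namespace Summit.ValiantsHypothesis.ValiantsHypothesis.Theorems.DivisionGap.PerCofactorDegreeReduction.TwoFactorHole

open Summit.ValiantsHypothesis.ValiantsHypothesis.Theorems.DivisionGap.PerCofactorDegreeReduction.GadgetPlacement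
  (exists_orbit)

/-! ### The cyclic predecessor along the orbit -/

/-- Along the orbit enumeration every column `col t` (`t < n`) is `π₀`-adjacent to the row
`ρ₀ (col s)` of its cyclic predecessor: `s + 1 = t`, or `s = n - 1` when `t = 0`. [folklore] -/
theorem exists_pred {n : ℕ} (hn : 1 ≤ n) (π₀ ρ₀ : Equiv.Perm (Fin n)) (col : ℕ → Fin n)
    (hstep : ∀ t, π₀ (col (t + 1)) = ρ₀ (col t)) (hper : col n = col 0) :
    ∀ t < n, ∃ s < n, π₀ (col t) = ρ₀ (col s) ∧ (s + 1 = t ∨ (t = 0 ∧ s + 1 = n)) := by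
  intro t ht
  by_cases ht0 : t = 0
  · subst ht0
    refine ⟨n - 1, by omega, ?_, Or.inr ⟨rfl, by omega⟩⟩
    rw [← hstep, Nat.sub_add_cancel hn, hper]
  · have h1 : 1 ≤ t := Nat.one_le_iff_ne_zero.mpr ht0
    refine ⟨t - 1, by omega, ?_, Or.inl (by omega)⟩
    rw [← hstep, Nat.sub_add_cancel h1]

/-! ### The hole and the matching along the orbit -/

/-- The interleaved hole, given the orbit enumeration `col` of the Hamiltonian 2-factor `π₀ ⊔ ρ₀`:
removed rows `ρ₀ (col (3a+1))` and removed columns `col (3b)` (`a, b < ⌊n/3⌋`), and the matching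
`col t ↦ π₀ (col t)` for `t < 3⌊n/3⌋` with `t ≡ 1 (mod 3)`, `col t ↦ ρ₀ (col t)` otherwise; the
block carries no cell of the 2-factor, and off the removed columns the matching stays inside the
2-factor, avoids the removed rows and is injective. [folklore] -/
theorem placement {n : ℕ} (hn : 1 ≤ n) (π₀ ρ₀ : Equiv.Perm (Fin n)) (col : ℕ → Fin n)
    (hstep : ∀ t, π₀ (col (t + 1)) = ρ₀ (col t))
    (hinj : ∀ s t, s < n → t < n → col s = col t → s = t) (hsurj : ∀ c, ∃ t < n, col t = c)
    (hper : col n = col 0) :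
    ∃ (er ec : Fin (n / 3) → Fin n) (M₀ : Fin n → Fin n),
      Function.Injective er ∧ Function.Injective ec ∧
      (∀ a b, π₀ (ec b) ≠ er a ∧ ρ₀ (ec b) ≠ er a) ∧
      (∀ j, (∀ b, ec b ≠ j) → (M₀ j = π₀ j ∨ M₀ j = ρ₀ j) ∧ ∀ a, er a ≠ M₀ j) ∧
      (∀ j j', (∀ b, ec b ≠ j) → (∀ b, ec b ≠ j') → M₀ j = M₀ j' → j = j') := by
  classical
  -- rows along the orbit are injective
  have hrow : ∀ s t, s < n → t < n → ρ₀ (col s) = ρ₀ (col t) → s = t :=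
    fun s t hs ht h => hinj s t hs ht (ρ₀.injective h)
  have hpred := exists_pred hn π₀ ρ₀ col hstep hper
  -- the inverse of the orbit enumeration
  choose idx hidx_lt hidx_eq using hsurj
  have hidx : ∀ t < n, idx (col t) = t := fun t ht => hinj _ _ (hidx_lt _) ht (hidx_eq _)
  -- the data
  obtain ⟨er, her⟩ : ∃ er : Fin (n / 3) → Fin n, ∀ a, er a = ρ₀ (col (3 * a.val + 1)) :=
    ⟨_, fun _ => rfl⟩
  obtain ⟨ec, hec⟩ : ∃ ec : Fin (n / 3) → Fin n, ∀ b, ec b = col (3 * b.val) := ⟨_, fun _ => rfl⟩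
  obtain ⟨M₀, hM₀⟩ : ∃ M₀ : Fin n → Fin n,
      ∀ j, M₀ j = if idx j < 3 * (n / 3) ∧ idx j % 3 = 1 then π₀ j else ρ₀ j :=
    ⟨_, fun _ => rfl⟩
  -- the row index of the matching along the orbit
  have hM : ∀ t < n, ∃ r < n, M₀ (col t) = ρ₀ (col r) ∧
      ((t < 3 * (n / 3) ∧ t % 3 = 1 ∧ r + 1 = t) ∨ (¬(t < 3 * (n / 3) ∧ t % 3 = 1) ∧ r = t)) := by
    intro t ht
    rw [hM₀, hidx t ht]
    by_cases h : t < 3 * (n / 3) ∧ t % 3 = 1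
    · obtain ⟨s, hs, hse, hs'⟩ := hpred t ht
      refine ⟨s, hs, ?_, Or.inl ⟨h.1, h.2, by omega⟩⟩
      rw [if_pos h, hse]
    · exact ⟨t, ht, by rw [if_neg h], Or.inr ⟨h, rfl⟩⟩
  -- the leftover columns along the orbit
  have hleft : ∀ t, (∀ b, ec b ≠ col t) → ¬(t < 3 * (n / 3) ∧ t % 3 = 0) := by
    rintro t hb ⟨h1, h2⟩
    refine hb ⟨t / 3, by omega⟩ ?_
    rw [hec]
    exact congrArg col (show 3 * (t / 3) = t by omega)
  refine ⟨er, ec, M₀, ?_, ?_, ?_, ?_, ?_⟩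
  · -- `er` is injective
    intro a a' h
    rw [her, her] at h
    have ha := a.isLt
    have ha' := a'.isLt
    exact Fin.ext (by have := hrow _ _ (by omega) (by omega) h; omega)
  · -- `ec` is injective
    intro b b' h
    rw [hec, hec] at h
    have hb := b.isLt
    have hb' := b'.isLt
    exact Fin.ext (by have := hinj _ _ (by omega) (by omega) h; omega)
  · -- the block carries no cell of the 2-factor
    intro a b
    rw [her, hec]
    have ha := a.isLt
    have hb := b.isLt
    obtain ⟨s, hs, hse, hs'⟩ := hpred (3 * b.val) (by omega)
    refine ⟨fun h => ?_, fun h => ?_⟩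
    · rw [hse] at h
      have := hrow _ _ hs (by omega) h
      omega
    · have := hrow _ _ (by omega) (by omega) h
      omega
  · -- the matching on the leftover columns: inside the 2-factor, off the removed rows
    intro j _
    refine ⟨?_, fun a h => ?_⟩
    · rw [hM₀]
      split_ifs
      exacts [Or.inl rfl, Or.inr rfl]
    · obtain ⟨t, ht, rfl⟩ : ∃ t < n, col t = j := ⟨idx j, hidx_lt j, hidx_eq j⟩
      obtain ⟨r, hr, hre, hr'⟩ := hM t ht
      rw [her, hre] at h
      have ha := a.isLt
      have := hrow _ _ (by omega) hr h
      omega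
  · -- the matching is injective on the leftover columns
    intro j j' hj hj' h
    obtain ⟨t, ht, rfl⟩ : ∃ t < n, col t = j := ⟨idx j, hidx_lt j, hidx_eq j⟩
    obtain ⟨t', ht', rfl⟩ : ∃ t' < n, col t' = j' := ⟨idx j', hidx_lt j', hidx_eq j'⟩
    obtain ⟨r, hr, hre, hr₁⟩ := hM t ht
    obtain ⟨r', hr', hre', hr₁'⟩ := hM t' ht'
    rw [hre, hre'] at h
    have hl := hleft t hj
    have hl' := hleft t' hj'
    have := hrow _ _ hr hr' h
    exact congrArg col (show t = t' by omega)

/-! ### The registered stub -/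

/-- **Stub M (an interleaved hole in a Hamiltonian 2-factor).**  If `π₀ ⊔ ρ₀` is Hamiltonian
(`π₀⁻¹ρ₀` an `n`-cycle with full support), then there are `⌊n/3⌋` rows `er` and `⌊n/3⌋` columns
`ec` such that the block `er × ec` contains no cell `(π₀ i, i)` or `(ρ₀ i, i)` of the 2-factor,
together with a matching `M₀` of the remaining columns inside the 2-factor (`M₀ j ∈ {π₀ j, ρ₀ j}`)
into rows off `er`, injective on the remaining columns.  Along the orbit `col` of `π₀⁻¹ρ₀`
(`r t = ρ₀ (col t) = π₀ (col (t+1))`): `ec b = col (3b)`, `er a = r (3a+1)`, and `M₀` sends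
`col (3s+1) ↦ r (3s)`, `col (3s+2) ↦ r (3s+2)`, `col t ↦ r t` for `t ≥ 3⌊n/3⌋`. [folklore] -/
theorem stub_twoFactorHole :
    ∀ (n : ℕ) (π₀ ρ₀ : Equiv.Perm (Fin n)),
      (π₀⁻¹ * ρ₀).IsCycle → (π₀⁻¹ * ρ₀).support = Finset.univ →
      ∃ (er ec : Fin (n / 3) → Fin n) (M₀ : Fin n → Fin n),
        Function.Injective er ∧ Function.Injective ec ∧
        (∀ a b, π₀ (ec b) ≠ er a ∧ ρ₀ (ec b) ≠ er a) ∧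
        (∀ j, (∀ b, ec b ≠ j) → (M₀ j = π₀ j ∨ M₀ j = ρ₀ j) ∧ ∀ a, er a ≠ M₀ j) ∧
        (∀ j j', (∀ b, ec b ≠ j) → (∀ b, ec b ≠ j') → M₀ j = M₀ j' → j = j') := by
  intro n π₀ ρ₀ hc hs
  have hn : 1 ≤ n := by
    obtain ⟨x, -⟩ := hc
    exact x.pos
  obtain ⟨col, hstep, hinj, hsurj, hper⟩ := exists_orbit hn π₀ ρ₀ hc hs
  exact placement hn π₀ ρ₀ col hstep hinj hsurj hper

end Summit.ValiantsHypothesis.ValiantsHypothesis.Theorems.DivisionGap.PerCofactorDegreeReduction.TwoFactorHole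

end
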